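import Literature.Probability.Percolation.OneArmAnnulusCrossingFromTrace
import Literature.Probability.Percolation.OneArmHullAvoidsOrigin
import HarnessLib

/-!
# LSW's (3.1) with Theorem 1.2 from the renewal / arc-coupling hypotheses (proofs only)

Topic `Literature/Probability/Percolation`; family `crit-perc`. Def-free, fact-free sequel of
`OneArmAnnulusCrossingFromTrace.lean` (the named fact
`Literature.Probability.Percolation.LawlerSchrammWerner2002_annulusCrossing` — Lawler–Schramm–Werner,
*One-arm exponent for critical 2D percolation*, Electron. J. Probab. **7** (2002), paper no. 2,
**Theorem 1.2** (p. 2) with **(3.1)** (p. 8) — from the *subsequential trace identification*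
`u(2π, t) = ν{K | 𝔯(K) ≤ e^{-t}}`, `t > 0`, at every weak limit `ν` of the hull laws
`lswLaw (R_k)`, `R_k → ∞`) and of `OneArmTraceIdentification.lean`, `OneArmNeumannCoupling.lean`,
`OneArmHullAvoidsOrigin.lean`, which derive that identification from LSW's own hypothesis sets of
§2 read at a subsequential limit `ν`:

* *renewal flatness* — `w_ν(0+) = 1` and two-sided `o((2π - θ)^{1/3})`-flatness at `2π` of the
  renewal extension of the window averages of `w_ν(t) = ν{𝔯 ≤ e^{-t}}`
  (`lswHit_two_pi_eq_measureReal_of_renewalFlat`);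
* *renewal domination + from-below flatness* — LSW's (2.10) for the arc hitting function with
  `h(θ, ·) ≤ h(2π, ·)`, and Lemma 2.3 weakened to order `o((2π - θ)^{1/3})`
  (`lswHit_two_pi_eq_measureReal_of_renewal`);
* *arc couplings* — for `θ ∈ (0, 2π)` a coupling `μ_θ` of `(Q(θ), Q(2π))` with second marginal `ν`,
  `Q(θ) ⊆ Q(2π)` a.s., **(2.10)** for its first marginal and the three-arm **tail (2.14)**
  (`lswHit_two_pi_eq_measureReal_of_arcCoupling`; `𝔯 > 0` a.s. is free at subsequential limits of
  `lswLaw`, `ae_conformalRadius_pos_of_subseqLimit`, RSW).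

Those files conclude, from each hypothesis set at all subsequential limits, the three facts
`LawlerSchrammWerner2002_hittingPDE`, `LawlerSchrammWerner2002_scalingLimitExponent` (LSW Thm. 1.2)
and `oneArm_exponent` (LSW Thm. 1.1) (`oneArm_exponent_of_subseqRenewalFlat`,
`oneArm_exponent_of_subseqRenewal`, `oneArm_exponent_of_subseqArcCoupling'`) — but not (3.1). This
file adds the fourth conjunct: **from each of the three hypothesis sets at the subsequential weak
limits, `LawlerSchrammWerner2002_annulusCrossing` holds**, and hence all four continuum statements
of the one-arm cone at once. Each proof is the corresponding trace identification fed into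
`LawlerSchrammWerner2002_annulusCrossing_of_subseqTrace` /
`LawlerSchrammWerner2002_continuumFacts_of_subseqTrace` (Koebe's `1/4` against the slack `2 · 2`
of the radii in (3.1), `OneArmAnnulusCrossingFromTrace.lean`). So whichever of the three shapes the
remaining probabilistic input of LSW §2 (Thm. 2.1, the `SLE₆` description of `Q(θ)`, giving (2.10);
the passage (2.13) ⇒ (2.14)) is delivered in, the discharge of
`LawlerSchrammWerner2002_annulusCrossing` is the same one-liner as that of the other three facts.

* `LawlerSchrammWerner2002_annulusCrossing_of_subseqRenewalFlat`,
  `LawlerSchrammWerner2002_continuumFacts_of_subseqRenewalFlat`;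
* `LawlerSchrammWerner2002_annulusCrossing_of_subseqRenewal`,
  `LawlerSchrammWerner2002_continuumFacts_of_subseqRenewal`;
* `LawlerSchrammWerner2002_annulusCrossing_of_subseqArcCoupling`,
  `LawlerSchrammWerner2002_continuumFacts_of_subseqArcCoupling`.

No discharge; no definitions; no named facts.

## References

* G. F. Lawler, O. Schramm, W. Werner, *One-arm exponent for critical 2D percolation*, Electron.
  J. Probab. 7 (2002), no. 2 — Thm. 1.1, Thm. 1.2 (p. 2), Thm. 2.1 (p. 3), (2.1)–(2.2) (p. 4),
  (2.10) (p. 6), Lemma 2.3 with (2.13)–(2.16) (pp. 6–7), §3 (3.1) (p. 8)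
  [LawlerSchrammWernerEJP2002].

## Mathlib / tree

Tree: `LawlerSchrammWerner2002_annulusCrossing_of_subseqTrace`,
`LawlerSchrammWerner2002_continuumFacts_of_subseqTrace` (`OneArmAnnulusCrossingFromTrace`),
`lswHit_two_pi_eq_measureReal_of_renewalFlat`, `lswHit_two_pi_eq_measureReal_of_renewal`
(`OneArmTraceIdentification`), `lswHit_two_pi_eq_measureReal_of_arcCoupling`
(`OneArmNeumannCoupling`), `ae_conformalRadius_pos_of_subseqLimit` (`OneArmHullAvoidsOrigin`).
Mathlib: nothing beyond these imports.
-/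

noncomputable section

open MeasureTheory Filter Topology Set Metric TopologicalSpace
open Literature.Probability.LatticeModels Literature.Analysis.Complex
  Literature.Probability.RandomPlanarGeometry Literature.Probability.RandomPlanarGeometry.RadialLoewner
open scoped ENNReal NNReal

namespace Literature.Probability.Percolation

/-! ### From renewal flatness at the subsequential limits -/

/-- **(3.1) with Thm. 1.2 from renewal flatness at the subsequential weak limits.** If every weak
limit `ν` of `lswLaw (R_k)`, `R_k → ∞`, has `w_ν(0+) = 1` and two-sided
`o((2π - θ)^{1/3})`-flat renewal extensions of the window averages of
`w_ν(t) = ν{K | 𝔯(K) ≤ e^{-t}}` at `θ = 2π` (the hypotheses of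
`lswHit_two_pi_eq_measureReal_of_renewalFlat`, i.e. what LSW's (2.10) and Lemma 2.3 provide), then
`LawlerSchrammWerner2002_annulusCrossing` holds: the trace identification
`u(2π, ·) = w_ν` on `(0, ∞)` at every subsequential limit, then
`LawlerSchrammWerner2002_annulusCrossing_of_subseqTrace`.
[cite: LawlerSchrammWernerEJP2002, Thm. 1.2 (p. 2), §2 (2.10), Lemma 2.3, §3 (3.1) (p. 8)] -/
theorem LawlerSchrammWerner2002_annulusCrossing_of_subseqRenewalFlat
    (h : ∀ (R : ℕ → ℝ) (ν : ProbabilityMeasure (NonemptyCompacts ℂ)),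
      Tendsto R atTop atTop → Tendsto (lswLaw ∘ R) atTop (𝓝 ν) →
      Tendsto (fun s : ℝ ↦ (ν : Measure (NonemptyCompacts ℂ)).real
        {K | conformalRadius (K : Set ℂ) ≤ Real.exp (-s)}) (𝓝[>] 0) (𝓝 1) ∧
      ∀ L ∈ Ioo (0 : ℝ) 1, ∀ t : ℝ, 0 < t → ∀ ε : ℝ, 0 < ε → ∀ᶠ θ in 𝓝[<] (2 * Real.pi),
        |renewalST 6 (fun s ↦ ∫ r in (0 : ℝ)..L, bottomDatum (s + r))
            (fun s ↦ ∫ r in (0 : ℝ)..L, (ν : Measure (NonemptyCompacts ℂ)).real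
              {K | conformalRadius (K : Set ℂ) ≤ Real.exp (-(s + r))}) θ t -
          ∫ r in (0 : ℝ)..L, (ν : Measure (NonemptyCompacts ℂ)).real
              {K | conformalRadius (K : Set ℂ) ≤ Real.exp (-(t + r))}|
          ≤ ε * (2 * Real.pi - θ) ^ (1 / 3 : ℝ)) :
    LawlerSchrammWerner2002_annulusCrossing :=
  LawlerSchrammWerner2002_annulusCrossing_of_subseqTrace fun R ν hR hν _ ht ↦
    lswHit_two_pi_eq_measureReal_of_renewalFlat ν (h R ν hR hν).1 (h R ν hR hν).2 ht

/-- **All four LSW continuum statements from renewal flatness at the subsequential weak limits**: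
`LawlerSchrammWerner2002_annulusCrossing` ((3.1) with Thm. 1.2), `LawlerSchrammWerner2002_hittingPDE`
(§2), `LawlerSchrammWerner2002_scalingLimitExponent` (Thm. 1.2) and `oneArm_exponent` (Thm. 1.1);
compare `oneArm_exponent_of_subseqRenewalFlat` (the last three).
[cite: LawlerSchrammWernerEJP2002, Thms. 1.1–1.2 (p. 2), §2–§3] -/
theorem LawlerSchrammWerner2002_continuumFacts_of_subseqRenewalFlat
    (h : ∀ (R : ℕ → ℝ) (ν : ProbabilityMeasure (NonemptyCompacts ℂ)),
      Tendsto R atTop atTop → Tendsto (lswLaw ∘ R) atTop (𝓝 ν) →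
      Tendsto (fun s : ℝ ↦ (ν : Measure (NonemptyCompacts ℂ)).real
        {K | conformalRadius (K : Set ℂ) ≤ Real.exp (-s)}) (𝓝[>] 0) (𝓝 1) ∧
      ∀ L ∈ Ioo (0 : ℝ) 1, ∀ t : ℝ, 0 < t → ∀ ε : ℝ, 0 < ε → ∀ᶠ θ in 𝓝[<] (2 * Real.pi),
        |renewalST 6 (fun s ↦ ∫ r in (0 : ℝ)..L, bottomDatum (s + r))
            (fun s ↦ ∫ r in (0 : ℝ)..L, (ν : Measure (NonemptyCompacts ℂ)).real
              {K | conformalRadius (K : Set ℂ) ≤ Real.exp (-(s + r))}) θ t -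
          ∫ r in (0 : ℝ)..L, (ν : Measure (NonemptyCompacts ℂ)).real
              {K | conformalRadius (K : Set ℂ) ≤ Real.exp (-(t + r))}|
          ≤ ε * (2 * Real.pi - θ) ^ (1 / 3 : ℝ)) :
    LawlerSchrammWerner2002_annulusCrossing ∧ LawlerSchrammWerner2002_hittingPDE ∧
      LawlerSchrammWerner2002_scalingLimitExponent ∧ oneArm_exponent :=
  LawlerSchrammWerner2002_continuumFacts_of_subseqTrace fun R ν hR hν _ ht ↦
    lswHit_two_pi_eq_measureReal_of_renewalFlat ν (h R ν hR hν).1 (h R ν hR hν).2 ht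

/-! ### From renewal domination and from-below flatness at the subsequential limits -/

/-- **(3.1) with Thm. 1.2 from LSW's hypothesis set at the subsequential weak limits.** If every
weak limit `ν` of `lswLaw (R_k)`, `R_k → ∞`, satisfies the hypotheses of
`lswHit_two_pi_eq_measureReal_of_renewal` — domination `renewalST 6 1_{≤0} w_ν θ s ≤ w_ν(s)` on
`(0, 2π) × ℝ` (LSW's (2.10) for the arc hitting function together with `h(θ, ·) ≤ h(2π, ·)`), and
the from-below Neumann estimate of Lemma 2.3 for the window averages to order
`o((2π - θ)^{1/3})` — then `LawlerSchrammWerner2002_annulusCrossing` holds.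
[cite: LawlerSchrammWernerEJP2002, Thm. 1.2 (p. 2), §2 (2.10), Lemma 2.3 (2.12), §3 (3.1) (p. 8)] -/
theorem LawlerSchrammWerner2002_annulusCrossing_of_subseqRenewal
    (h : ∀ (R : ℕ → ℝ) (ν : ProbabilityMeasure (NonemptyCompacts ℂ)),
      Tendsto R atTop atTop → Tendsto (lswLaw ∘ R) atTop (𝓝 ν) →
      (∀ θ ∈ Ioo 0 (2 * Real.pi), ∀ s : ℝ,
        renewalST 6 bottomDatum (fun s ↦ (ν : Measure (NonemptyCompacts ℂ)).real
          {K | conformalRadius (K : Set ℂ) ≤ Real.exp (-s)}) θ s ≤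
          (ν : Measure (NonemptyCompacts ℂ)).real {K | conformalRadius (K : Set ℂ) ≤ Real.exp (-s)}) ∧
      ∀ L ∈ Ioo (0 : ℝ) 1, ∀ t : ℝ, 0 < t → ∀ ε : ℝ, 0 < ε → ∀ᶠ θ in 𝓝[<] (2 * Real.pi),
        -(ε * (2 * Real.pi - θ) ^ (1 / 3 : ℝ)) ≤
          renewalST 6 (fun s ↦ ∫ r in (0 : ℝ)..L, bottomDatum (s + r))
            (fun s ↦ ∫ r in (0 : ℝ)..L, (ν : Measure (NonemptyCompacts ℂ)).real
              {K | conformalRadius (K : Set ℂ) ≤ Real.exp (-(s + r))}) θ t -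
          ∫ r in (0 : ℝ)..L, (ν : Measure (NonemptyCompacts ℂ)).real
              {K | conformalRadius (K : Set ℂ) ≤ Real.exp (-(t + r))}) :
    LawlerSchrammWerner2002_annulusCrossing :=
  LawlerSchrammWerner2002_annulusCrossing_of_subseqTrace fun R ν hR hν _ ht ↦
    lswHit_two_pi_eq_measureReal_of_renewal ν (h R ν hR hν).1 (h R ν hR hν).2 ht

/-- **All four LSW continuum statements from LSW's hypothesis set at the subsequential weak
limits** (renewal domination + from-below flatness); compare `oneArm_exponent_of_subseqRenewal`
(the last three). [cite: LawlerSchrammWernerEJP2002, Thms. 1.1–1.2 (p. 2), §2–§3] -/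
theorem LawlerSchrammWerner2002_continuumFacts_of_subseqRenewal
    (h : ∀ (R : ℕ → ℝ) (ν : ProbabilityMeasure (NonemptyCompacts ℂ)),
      Tendsto R atTop atTop → Tendsto (lswLaw ∘ R) atTop (𝓝 ν) →
      (∀ θ ∈ Ioo 0 (2 * Real.pi), ∀ s : ℝ,
        renewalST 6 bottomDatum (fun s ↦ (ν : Measure (NonemptyCompacts ℂ)).real
          {K | conformalRadius (K : Set ℂ) ≤ Real.exp (-s)}) θ s ≤
          (ν : Measure (NonemptyCompacts ℂ)).real {K | conformalRadius (K : Set ℂ) ≤ Real.exp (-s)}) ∧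
      ∀ L ∈ Ioo (0 : ℝ) 1, ∀ t : ℝ, 0 < t → ∀ ε : ℝ, 0 < ε → ∀ᶠ θ in 𝓝[<] (2 * Real.pi),
        -(ε * (2 * Real.pi - θ) ^ (1 / 3 : ℝ)) ≤
          renewalST 6 (fun s ↦ ∫ r in (0 : ℝ)..L, bottomDatum (s + r))
            (fun s ↦ ∫ r in (0 : ℝ)..L, (ν : Measure (NonemptyCompacts ℂ)).real
              {K | conformalRadius (K : Set ℂ) ≤ Real.exp (-(s + r))}) θ t -
          ∫ r in (0 : ℝ)..L, (ν : Measure (NonemptyCompacts ℂ)).real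
              {K | conformalRadius (K : Set ℂ) ≤ Real.exp (-(t + r))}) :
    LawlerSchrammWerner2002_annulusCrossing ∧ LawlerSchrammWerner2002_hittingPDE ∧
      LawlerSchrammWerner2002_scalingLimitExponent ∧ oneArm_exponent :=
  LawlerSchrammWerner2002_continuumFacts_of_subseqTrace fun R ν hR hν _ ht ↦
    lswHit_two_pi_eq_measureReal_of_renewal ν (h R ν hR hν).1 (h R ν hR hν).2 ht

/-! ### From arc couplings at the subsequential limits -/

/-- **(3.1) with Thm. 1.2 from arc couplings at the subsequential weak limits.** If every weak
limit `ν` of `lswLaw (R_k)`, `R_k → ∞`, admits for `θ ∈ (0, 2π)` couplings `μ_θ` of pairs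
`(K_θ, K_{2π})` of non-empty compacts with second marginal `ν`, `K_θ ⊆ K_{2π}` a.s., LSW's
**(2.10)** `μ_θ{𝔯(K_θ) ≤ e^{-s}} = renewalST 6 1_{≤0} w_ν θ s` for the first marginal, and the
three-arm **tail (2.14)** `μ_θ{K_{2π} ⊄ K_θ ∪ B̄(1, r)} ≤ c ((2π - θ)/r)^γ` (`γ > 1`, `θ` near `2π`,
`r > 0`) — the hypothesis of `oneArm_exponent_of_subseqArcCoupling'` — then
`LawlerSchrammWerner2002_annulusCrossing` holds: `𝔯 > 0` `ν`-a.s. by RSW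
(`ae_conformalRadius_pos_of_subseqLimit`), the trace identification by
`lswHit_two_pi_eq_measureReal_of_arcCoupling`, then `LawlerSchrammWerner2002_annulusCrossing_of_subseqTrace`.
[cite: LawlerSchrammWernerEJP2002, Thm. 1.2 (p. 2), Thm. 2.1 (p. 3), §2 (2.10), (2.14), §3 (3.1) (p. 8)] -/
theorem LawlerSchrammWerner2002_annulusCrossing_of_subseqArcCoupling
    (h : ∀ (R : ℕ → ℝ) (ν : ProbabilityMeasure (NonemptyCompacts ℂ)),
      Tendsto R atTop atTop → Tendsto (lswLaw ∘ R) atTop (𝓝 ν) →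
      ∃ μ : ℝ → ProbabilityMeasure (NonemptyCompacts ℂ × NonemptyCompacts ℂ),
        (∀ θ ∈ Ioo 0 (2 * Real.pi),
          (μ θ : Measure (NonemptyCompacts ℂ × NonemptyCompacts ℂ)).map Prod.snd = ν) ∧
        (∀ θ ∈ Ioo 0 (2 * Real.pi), ∀ᵐ p ∂(μ θ : Measure (NonemptyCompacts ℂ × NonemptyCompacts ℂ)),
          ((p.1 : NonemptyCompacts ℂ) : Set ℂ) ⊆ (p.2 : Set ℂ)) ∧
        (∀ θ ∈ Ioo 0 (2 * Real.pi), ∀ s : ℝ,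
          (μ θ : Measure (NonemptyCompacts ℂ × NonemptyCompacts ℂ)).real
              {p | conformalRadius ((p.1 : NonemptyCompacts ℂ) : Set ℂ) ≤ Real.exp (-s)} =
            renewalST 6 bottomDatum (fun s ↦ (ν : Measure (NonemptyCompacts ℂ)).real
              {K | conformalRadius (K : Set ℂ) ≤ Real.exp (-s)}) θ s) ∧
        ∃ θ₁ c γ : ℝ, θ₁ < 2 * Real.pi ∧ 1 < γ ∧
          ∀ θ ∈ Ioo θ₁ (2 * Real.pi), ∀ r : ℝ, 0 < r →
            (μ θ : Measure (NonemptyCompacts ℂ × NonemptyCompacts ℂ)).real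
                {p | ¬ (((p.2 : NonemptyCompacts ℂ) : Set ℂ) ⊆ (p.1 : Set ℂ) ∪ closedBall (1 : ℂ) r)} ≤
              c * ((2 * Real.pi - θ) / r) ^ γ) :
    LawlerSchrammWerner2002_annulusCrossing := by
  refine LawlerSchrammWerner2002_annulusCrossing_of_subseqTrace fun R ν hR hν t ht ↦ ?_
  obtain ⟨μ, hsnd, hsub, h210, θ₁, c, γ, hθ₁, hγ, htail⟩ := h R ν hR hν
  exact lswHit_two_pi_eq_measureReal_of_arcCoupling ν μ (ae_conformalRadius_pos_of_subseqLimit R ν hR hν)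
    hsnd hsub h210 hθ₁ hγ htail ht

/-- **All four LSW continuum statements from arc couplings at the subsequential weak limits**:
`LawlerSchrammWerner2002_annulusCrossing`, `LawlerSchrammWerner2002_hittingPDE`,
`LawlerSchrammWerner2002_scalingLimitExponent` and `oneArm_exponent` follow from the existence, at
every subsequential weak limit of `lswLaw`, of arc couplings with LSW's (2.10) and the tail (2.14)
alone; compare `oneArm_exponent_of_subseqArcCoupling'` (the last three). What is left of LSW §2 for
the whole one-arm cone is the construction of these couplings: the joint subsequential limits of the
laws of `(Q_δ(θ), Q_δ(2π))` exist (`exists_tendsto_subseq_pairLaw`) and inherit inclusion, second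
marginal and the tail (2.14) from (2.13) (`arcCoupling_of_tendsto`, `OneArmArcCouplingLimit.lean`);
the one missing input is (2.10) for their first marginal — LSW's Thm. 2.1 (Smirnov: the `SLE₆`
description of `Q(θ)`) with the radial `SLE₆` computation (2.5)–(2.9).
[cite: LawlerSchrammWernerEJP2002, Thms. 1.1–1.2 (p. 2), Thm. 2.1 (p. 3), §2 (2.10), (2.14), §3] -/
theorem LawlerSchrammWerner2002_continuumFacts_of_subseqArcCoupling
    (h : ∀ (R : ℕ → ℝ) (ν : ProbabilityMeasure (NonemptyCompacts ℂ)),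
      Tendsto R atTop atTop → Tendsto (lswLaw ∘ R) atTop (𝓝 ν) →
      ∃ μ : ℝ → ProbabilityMeasure (NonemptyCompacts ℂ × NonemptyCompacts ℂ),
        (∀ θ ∈ Ioo 0 (2 * Real.pi),
          (μ θ : Measure (NonemptyCompacts ℂ × NonemptyCompacts ℂ)).map Prod.snd = ν) ∧
        (∀ θ ∈ Ioo 0 (2 * Real.pi), ∀ᵐ p ∂(μ θ : Measure (NonemptyCompacts ℂ × NonemptyCompacts ℂ)),
          ((p.1 : NonemptyCompacts ℂ) : Set ℂ) ⊆ (p.2 : Set ℂ)) ∧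
        (∀ θ ∈ Ioo 0 (2 * Real.pi), ∀ s : ℝ,
          (μ θ : Measure (NonemptyCompacts ℂ × NonemptyCompacts ℂ)).real
              {p | conformalRadius ((p.1 : NonemptyCompacts ℂ) : Set ℂ) ≤ Real.exp (-s)} =
            renewalST 6 bottomDatum (fun s ↦ (ν : Measure (NonemptyCompacts ℂ)).real
              {K | conformalRadius (K : Set ℂ) ≤ Real.exp (-s)}) θ s) ∧
        ∃ θ₁ c γ : ℝ, θ₁ < 2 * Real.pi ∧ 1 < γ ∧
          ∀ θ ∈ Ioo θ₁ (2 * Real.pi), ∀ r : ℝ, 0 < r →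
            (μ θ : Measure (NonemptyCompacts ℂ × NonemptyCompacts ℂ)).real
                {p | ¬ (((p.2 : NonemptyCompacts ℂ) : Set ℂ) ⊆ (p.1 : Set ℂ) ∪ closedBall (1 : ℂ) r)} ≤
              c * ((2 * Real.pi - θ) / r) ^ γ) :
    LawlerSchrammWerner2002_annulusCrossing ∧ LawlerSchrammWerner2002_hittingPDE ∧
      LawlerSchrammWerner2002_scalingLimitExponent ∧ oneArm_exponent := by
  refine LawlerSchrammWerner2002_continuumFacts_of_subseqTrace fun R ν hR hν t ht ↦ ?_
  obtain ⟨μ, hsnd, hsub, h210, θ₁, c, γ, hθ₁, hγ, htail⟩ := h R ν hR hν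
  exact lswHit_two_pi_eq_measureReal_of_arcCoupling ν μ (ae_conformalRadius_pos_of_subseqLimit R ν hR hν)
    hsnd hsub h210 hθ₁ hγ htail ht

end Literature.Probability.Percolation
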